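import Literature.Analysis.PDE.SecondOrderHyperbolicUniqueness
import HarnessLib

/-!
# Uniqueness in the domain of dependence for quasilinear second-order hyperbolic systems

The uniqueness mechanism of Hawking–Ellis 1973, §7.5, Prop. 7.5.1 (developments of the reduced
empty space Einstein equations (7.44)–(7.46) are locally unique), in classical form and for a
general **quasilinear diagonal second-order system**

  `𝔞(p, u) u_tt − 2 ∑ᵢ 𝔟ⁱ(p, u) u_ti − ∑ᵢⱼ 𝔊ⁱʲ(p, u) u_ij = 𝔑(p, u, u_t, ∇u)`,  `u : ℝ × ℝᵈ → F`,

with smooth coefficient functions `𝔞, 𝔟, 𝔊 = 𝔊ᵀ` of `(p, u)` and smooth right-hand side `𝔑` of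
the `1`-jet (`F` a finite-dimensional real inner product space): two smooth solutions `u₁, u₂` on a
cylinder `Z = [0, T] × B̄(x₁, ρ)` with the same Cauchy data on `B̄(x₁, ρ)`, the operator being
hyperbolic along `u₁` (`𝔞(·, u₁) ≥ λ > 0`, `𝔊(·, u₁) ≥ λ` on `Z`), agree on a solid cone
`{0 ≤ t ≤ T, dist(x, x₁) < ρ − c t}` (`VarWave.exists_slope_eq_of_quasilinear`).

Proof ("the difference trick", Hawking–Ellis p. 249 via Prop. 7.4.5; John, *PDE*, Ch. 5 §3): the
difference `w = u₁ − u₂` satisfies the *linear* differential inequality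
`‖𝔞(·,u₁) w_tt − 2 𝔟(·,u₁) w_ti − 𝔊(·,u₁) w_ij‖ ≤ L (‖w‖ + ‖w_t‖ + ∑ ‖w_i‖)` on `Z` — the
coefficients and `𝔑` are locally Lipschitz (mean value inequality on the compact convex sets
`Z × B̄`), and the second derivatives of `u₂` are bounded on `Z` — so the linear theorem
`VarWave.exists_slope_eq_zero_of_norm_le` (`SecondOrderHyperbolicUniqueness.lean`) applies.

Consequences in the same classical setting: by time reflection `t ↦ −t` (`VarWave.timeReflect`,
`op_comp_timeReflect`) the two-sided statement `VarWave.eventually_eq_of_quasilinear` (agreement on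
a neighbourhood of the base point when the hypotheses hold on `[−T, T] × B̄(x₁, ρ)`), and, by
smooth cut-offs of the solutions and of the coefficients (`contDiff_bump_smul`) and a cylinder
chosen by continuity, the germ statement `VarWave.eventually_eq_of_quasilinear_germ`: coefficients
smooth only on open sets containing the base jets, solutions smooth only near the base point,
equations and data given as germs, hyperbolicity only at the base jet. The positivity hypothesis for
`ℝᴵ`-valued systems follows from the matrix condition (`sum_sum_mul_inner_ge`).
Everything in this file is proved; there are no named facts.

## References

* S. W. Hawking, G. F. R. Ellis, *The large scale structure of space-time*, CUP 1973, §7.5,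
  Prop. 7.5.1, and §7.4, Prop. 7.4.5. [HawkingEllis1973CUP]
* F. John, *Partial Differential Equations*, 4th ed., Springer 1982, Ch. 5 §3. [John1982]
-/

noncomputable section

open Set Filter MeasureTheory Metric
open scoped Topology ContDiff RealInnerProductSpace

namespace Literature.Analysis.PDE

namespace VarWave

variable {d : ℕ} {F : Type*} [NormedAddCommGroup F] [InnerProductSpace ℝ F]

/-! ### Linearity of the jet notation and of the operator -/

section Linear

variable {u v : Pt d → F} (hu : ContDiff ℝ ∞ u) (hv : ContDiff ℝ ∞ v)
include hu hv

/-- `(u − v)_t = u_t − v_t`. [folklore] -/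
theorem dT_sub (p : Pt d) : dT (u - v) p = dT u p - dT v p := by
  unfold dT
  rw [fderiv_sub ((hu.differentiable (by simp)) p) ((hv.differentiable (by simp)) p)]
  rfl

/-- `(u − v)_i = u_i − v_i`. [folklore] -/
theorem dX_sub (i : Fin d) (p : Pt d) : dX (u - v) i p = dX u i p - dX v i p := by
  unfold dX
  rw [fderiv_sub ((hu.differentiable (by simp)) p) ((hv.differentiable (by simp)) p)]
  rfl

/-- `(u − v)_t = u_t − v_t` as functions. [folklore] -/
theorem dT_sub_eq : dT (u - v) = dT u - dT v := funext fun p ↦ dT_sub hu hv p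

/-- `(u − v)_i = u_i − v_i` as functions. [folklore] -/
theorem dX_sub_eq (i : Fin d) : dX (u - v) i = dX u i - dX v i := funext fun p ↦ dX_sub hu hv i p

/-- `(u − v)_tt = u_tt − v_tt`. [folklore] -/
theorem dTT_sub (p : Pt d) : dTT (u - v) p = dTT u p - dTT v p := by
  unfold dTT
  rw [dT_sub_eq hu hv, fderiv_sub (((contDiff_dT hu).differentiable (by simp)) p)
    (((contDiff_dT hv).differentiable (by simp)) p)]
  rfl

/-- `(u − v)_ti = u_ti − v_ti`. [folklore] -/
theorem dTX_sub (i : Fin d) (p : Pt d) : dTX (u - v) i p = dTX u i p - dTX v i p := by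
  unfold dTX
  rw [dT_sub_eq hu hv, fderiv_sub (((contDiff_dT hu).differentiable (by simp)) p)
    (((contDiff_dT hv).differentiable (by simp)) p)]
  rfl

/-- `(u − v)_ij = u_ij − v_ij`. [folklore] -/
theorem dXX_sub (i j : Fin d) (p : Pt d) : dXX (u - v) i j p = dXX u i j p - dXX v i j p := by
  unfold dXX
  rw [dX_sub_eq hu hv, fderiv_sub (((contDiff_dX hu j).differentiable (by simp)) p)
    (((contDiff_dX hv j).differentiable (by simp)) p)]
  rfl

/-- `P (u − v) = P u − P v` (the operator is linear). [folklore] -/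
theorem op_sub (a : Pt d → ℝ) (b : Fin d → Pt d → ℝ) (G : Fin d → Fin d → Pt d → ℝ) (p : Pt d) :
    op (u - v) a b G p = op u a b G p - op v a b G p := by
  unfold op
  simp only [dTT_sub hu hv, dTX_sub hu hv, dXX_sub hu hv, smul_sub, Finset.sum_sub_distrib]
  abel

end Linear

/-- Dependence of `P u` on the coefficients:
`P_{a,b,G} u − P_{a',b',G'} u = (a − a') u_tt − 2 ∑ (bⁱ − b'ⁱ) u_ti − ∑ (Gⁱʲ − G'ⁱʲ) u_ij`.
[folklore] -/
theorem op_sub_op (u : Pt d → F) (a a' : Pt d → ℝ) (b b' : Fin d → Pt d → ℝ)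
    (G G' : Fin d → Fin d → Pt d → ℝ) (p : Pt d) :
    op u a b G p - op u a' b' G' p =
      (a p - a' p) • dTT u p - (2 : ℝ) • ∑ i, (b i p - b' i p) • dTX u i p -
        ∑ i, ∑ j, (G i j p - G' i j p) • dXX u i j p := by
  unfold op
  simp only [sub_smul, Finset.sum_sub_distrib, smul_sub]
  abel

/-! ### The norm of a `1`-jet difference -/

omit [InnerProductSpace ℝ F] in
/-- `‖(0, v, w, X)‖ ≤ ‖v‖ + ‖w‖ + ∑ ‖Xᵢ‖` in `(ℝ × ℝᵈ) × F × F × (Fin d → F)`. [folklore] -/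
theorem norm_zero_prod_le (v w : F) (X : Fin d → F) :
    ‖((0 : Pt d), v, w, X)‖ ≤ ‖v‖ + ‖w‖ + ∑ i, ‖X i‖ := by
  simp only [Prod.norm_def, norm_zero]
  have hX : ‖X‖ ≤ ∑ i, ‖X i‖ := by
    refine (pi_norm_le_iff_of_nonneg (by positivity)).2 fun i ↦ ?_
    exact Finset.single_le_sum (f := fun i ↦ ‖X i‖) (fun _ _ ↦ norm_nonneg _) (Finset.mem_univ i)
  have := norm_nonneg v
  have := norm_nonneg w
  have : 0 ≤ ∑ i, ‖X i‖ := by positivity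
  simp only [max_le_iff]
  refine ⟨by linarith, by linarith, by linarith, hX.trans (by linarith)⟩

omit [InnerProductSpace ℝ F] in
/-- `‖(0, v)‖ = ‖v‖` in `(ℝ × ℝᵈ) × F`. [folklore] -/
theorem norm_zero_prod (v : F) : ‖((0 : Pt d), v)‖ = ‖v‖ := by simp [Prod.norm_def]

/-! ### The theorem -/

section Quasilinear

variable [FiniteDimensional ℝ F]

/-- **Uniqueness in the domain of dependence for quasilinear diagonal second-order hyperbolic
systems** (the uniqueness clause of Hawking–Ellis, Prop. 7.5.1, in classical form). Let
`𝔞, 𝔟ⁱ, 𝔊ⁱʲ = 𝔊ʲⁱ : (ℝ × ℝᵈ) × F → ℝ` and `𝔑 : (ℝ × ℝᵈ) × F × F × (Fin d → F) → F` be smooth, and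
let `u₁, u₂ : ℝ × ℝᵈ → F` be smooth solutions of
`𝔞(p, u) u_tt − 2 ∑ 𝔟ⁱ(p, u) u_ti − ∑ 𝔊ⁱʲ(p, u) u_ij = 𝔑(p, u, u_t, ∇u)` on the cylinder
`Z = [0, T] × B̄(x₁, ρ)`, the operator being hyperbolic along `u₁` (`𝔞(·, u₁) ≥ λ > 0` and
`∑ 𝔊ⁱʲ(·, u₁) ⟪Xᵢ, Xⱼ⟫ ≥ λ ∑ ‖Xᵢ‖²` on `Z`), with the same Cauchy data `u₁ = u₂`, `∂ₜu₁ = ∂ₜu₂` on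
`{0} × B̄(x₁, ρ)`. Then `u₁ = u₂` on a solid cone `{0 ≤ t ≤ T, dist(x, x₁) < ρ − c t}`, `c > 0`.
[cite: HawkingEllis1973CUP, §7.5, Prop. 7.5.1 (uniqueness), with §7.4, Prop. 7.4.5]
[cite: John1982, Ch. 5 §3] -/
theorem exists_slope_eq_of_quasilinear
    {𝔞 : Pt d × F → ℝ} {𝔟 : Fin d → Pt d × F → ℝ} {𝔊 : Fin d → Fin d → Pt d × F → ℝ}
    {𝔑 : Pt d × F × F × (Fin d → F) → F}
    (h𝔞 : ContDiff ℝ ∞ 𝔞) (h𝔟 : ∀ i, ContDiff ℝ ∞ (𝔟 i)) (h𝔊 : ∀ i j, ContDiff ℝ ∞ (𝔊 i j))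
    (h𝔊s : ∀ i j q, 𝔊 i j q = 𝔊 j i q) (h𝔑 : ContDiff ℝ ∞ 𝔑)
    {T ρ lam : ℝ} {x₁ : EuclideanSpace ℝ (Fin d)} (hlam : 0 < lam)
    {u₁ u₂ : Pt d → F} (hu₁ : ContDiff ℝ ∞ u₁) (hu₂ : ContDiff ℝ ∞ u₂)
    (hapos : ∀ p ∈ Icc 0 T ×ˢ closedBall x₁ ρ, lam ≤ 𝔞 (p, u₁ p))
    (hGpos : ∀ p ∈ Icc 0 T ×ˢ closedBall x₁ ρ, ∀ X : Fin d → F,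
      lam * ∑ i, ‖X i‖ ^ 2 ≤ ∑ i, ∑ j, 𝔊 i j (p, u₁ p) * ⟪X i, X j⟫)
    (h₁ : ∀ p ∈ Icc 0 T ×ˢ closedBall x₁ ρ,
      op u₁ (fun q ↦ 𝔞 (q, u₁ q)) (fun i q ↦ 𝔟 i (q, u₁ q)) (fun i j q ↦ 𝔊 i j (q, u₁ q)) p =
        𝔑 (p, u₁ p, dT u₁ p, fun i ↦ dX u₁ i p))
    (h₂ : ∀ p ∈ Icc 0 T ×ˢ closedBall x₁ ρ,
      op u₂ (fun q ↦ 𝔞 (q, u₂ q)) (fun i q ↦ 𝔟 i (q, u₂ q)) (fun i j q ↦ 𝔊 i j (q, u₂ q)) p =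
        𝔑 (p, u₂ p, dT u₂ p, fun i ↦ dX u₂ i p))
    (h0 : ∀ x ∈ closedBall x₁ ρ, u₁ (0, x) = u₂ (0, x))
    (h1 : ∀ x ∈ closedBall x₁ ρ, dT u₁ (0, x) = dT u₂ (0, x)) :
    ∃ c : ℝ, 0 < c ∧ ∀ t ∈ Icc 0 T, ∀ x, dist x x₁ < ρ - c * t → u₁ (t, x) = u₂ (t, x) := by
  have hsm : (∞ : WithTop ℕ∞) ≠ 0 := by simp
  -- the frozen (linear) coefficients along `u₁` and along `u₂`
  set a₁ : Pt d → ℝ := fun q ↦ 𝔞 (q, u₁ q) with ha₁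
  set b₁ : Fin d → Pt d → ℝ := fun i q ↦ 𝔟 i (q, u₁ q) with hb₁
  set G₁ : Fin d → Fin d → Pt d → ℝ := fun i j q ↦ 𝔊 i j (q, u₁ q) with hG₁
  set a₂ : Pt d → ℝ := fun q ↦ 𝔞 (q, u₂ q) with ha₂
  set b₂ : Fin d → Pt d → ℝ := fun i q ↦ 𝔟 i (q, u₂ q) with hb₂
  set G₂ : Fin d → Fin d → Pt d → ℝ := fun i j q ↦ 𝔊 i j (q, u₂ q) with hG₂
  have hg₁ : ContDiff ℝ ∞ fun q : Pt d ↦ (q, u₁ q) := contDiff_id.prodMk hu₁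
  have ha₁s : ContDiff ℝ ∞ a₁ := h𝔞.comp hg₁
  have hb₁s : ∀ i, ContDiff ℝ ∞ (b₁ i) := fun i ↦ (h𝔟 i).comp hg₁
  have hG₁s : ∀ i j, ContDiff ℝ ∞ (G₁ i j) := fun i j ↦ (h𝔊 i j).comp hg₁
  obtain ⟨c, hc, H⟩ := exists_slope_eq_zero_of_norm_le (F := F) ha₁s hb₁s hG₁s
    (fun i j p ↦ h𝔊s i j _) hlam hapos hGpos
  refine ⟨c, hc, fun t ht x hx ↦ ?_⟩
  set Z : Set (Pt d) := Icc 0 T ×ˢ closedBall x₁ ρ with hZ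
  have hZc : IsCompact Z := isCompact_Icc.prod (isCompact_closedBall x₁ ρ)
  have hZconv : Convex ℝ Z := (convex_Icc 0 T).prod (convex_closedBall x₁ ρ)
  -- a common bound `R` for the `1`-jets of `u₁`, `u₂` on `Z`
  set Ψ : Pt d → ℝ := fun p ↦ ‖u₁ p‖ + ‖u₂ p‖ + ‖dT u₁ p‖ + ‖dT u₂ p‖ +
    ∑ i, (‖dX u₁ i p‖ + ‖dX u₂ i p‖) with hΨ
  have hΨc : Continuous Ψ :=
    (((hu₁.continuous.norm.add hu₂.continuous.norm).add (contDiff_dT hu₁).continuous.norm).add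
      (contDiff_dT hu₂).continuous.norm).add (continuous_finsetSum _ fun i _ ↦
        ((contDiff_dX hu₁ i).continuous.norm).add (contDiff_dX hu₂ i).continuous.norm)
  obtain ⟨R', hR'⟩ := hZc.exists_bound_of_continuousOn hΨc.continuousOn
  set R := max R' 0 with hRdef
  have hΨle : ∀ p ∈ Z, Ψ p ≤ R := fun p hp ↦ by
    have h := hR' p hp
    rw [Real.norm_of_nonneg (by positivity)] at h
    exact h.trans (le_max_left _ _)
  have hjet : ∀ p ∈ Z, ‖u₁ p‖ ≤ R ∧ ‖u₂ p‖ ≤ R ∧ ‖dT u₁ p‖ ≤ R ∧ ‖dT u₂ p‖ ≤ R ∧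
      (∀ i, ‖dX u₁ i p‖ ≤ R) ∧ ∀ i, ‖dX u₂ i p‖ ≤ R := by
    intro p hp
    have h := hΨle p hp
    have hS : ∀ i, ‖dX u₁ i p‖ + ‖dX u₂ i p‖ ≤ ∑ i, (‖dX u₁ i p‖ + ‖dX u₂ i p‖) := fun i ↦
      Finset.single_le_sum (f := fun i ↦ ‖dX u₁ i p‖ + ‖dX u₂ i p‖) (fun _ _ ↦ by positivity)
        (Finset.mem_univ i)
    have hSnn : 0 ≤ ∑ i, (‖dX u₁ i p‖ + ‖dX u₂ i p‖) := by positivity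
    have := norm_nonneg (u₁ p); have := norm_nonneg (u₂ p)
    have := norm_nonneg (dT u₁ p); have := norm_nonneg (dT u₂ p)
    simp only [hΨ] at h
    refine ⟨by linarith, by linarith, by linarith, by linarith, fun i ↦ ?_, fun i ↦ ?_⟩
    · have := hS i; have := norm_nonneg (dX u₂ i p); linarith
    · have := hS i; have := norm_nonneg (dX u₁ i p); linarith
  -- Lipschitz constant of the coefficients on `Z × B̄(0, R)`
  set K₁ : Set (Pt d × F) := Z ×ˢ closedBall 0 R with hK₁
  have hK₁c : IsCompact K₁ := hZc.prod (isCompact_closedBall 0 R)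
  have hK₁conv : Convex ℝ K₁ := hZconv.prod (convex_closedBall 0 R)
  obtain ⟨Ca, hCa⟩ := hK₁c.exists_bound_of_continuousOn
    ((h𝔞.continuous_fderiv (by simp)).continuousOn)
  choose Cb hCb using fun i ↦ hK₁c.exists_bound_of_continuousOn
    (((h𝔟 i).continuous_fderiv (by simp)).continuousOn)
  choose CG hCG using fun i j ↦ hK₁c.exists_bound_of_continuousOn
    (((h𝔊 i j).continuous_fderiv (by simp)).continuousOn)
  set C : ℝ := max Ca 0 + ∑ i, max (Cb i) 0 + ∑ i, ∑ j, max (CG i j) 0 with hCdef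
  have hsum1 : 0 ≤ ∑ i, max (Cb i) 0 := Finset.sum_nonneg fun i _ ↦ le_max_right _ _
  have hsum2 : 0 ≤ ∑ i, ∑ j, max (CG i j) 0 :=
    Finset.sum_nonneg fun i _ ↦ Finset.sum_nonneg fun j _ ↦ le_max_right _ _
  have hC : 0 ≤ C := by have := le_max_right Ca 0; positivity
  have hCa' : ∀ q ∈ K₁, ‖fderiv ℝ 𝔞 q‖ ≤ C := fun q hq ↦
    (hCa q hq).trans (by have := le_max_left Ca 0; linarith)
  have hCb' : ∀ i, ∀ q ∈ K₁, ‖fderiv ℝ (𝔟 i) q‖ ≤ C := fun i q hq ↦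
    (hCb i q hq).trans (by
      have h1 := le_max_left (Cb i) 0
      have h2 : max (Cb i) 0 ≤ ∑ i, max (Cb i) 0 :=
        Finset.single_le_sum (f := fun i ↦ max (Cb i) 0) (fun _ _ ↦ le_max_right _ _)
          (Finset.mem_univ i)
      have := le_max_right Ca 0
      linarith)
  have hCG' : ∀ i j, ∀ q ∈ K₁, ‖fderiv ℝ (𝔊 i j) q‖ ≤ C := fun i j q hq ↦
    (hCG i j q hq).trans (by
      have h1 := le_max_left (CG i j) 0
      have h2 : max (CG i j) 0 ≤ ∑ j, max (CG i j) 0 :=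
        Finset.single_le_sum (f := fun j ↦ max (CG i j) 0) (fun _ _ ↦ le_max_right _ _)
          (Finset.mem_univ j)
      have h3 : ∑ j, max (CG i j) 0 ≤ ∑ i, ∑ j, max (CG i j) 0 :=
        Finset.single_le_sum (f := fun i ↦ ∑ j, max (CG i j) 0)
          (fun _ _ ↦ Finset.sum_nonneg fun j _ ↦ le_max_right _ _) (Finset.mem_univ i)
      have := le_max_right Ca 0
      linarith)
  -- Lipschitz constant of `𝔑` on `Z × B̄ × B̄ × B̄`
  set K₂ : Set (Pt d × F × F × (Fin d → F)) :=
    Z ×ˢ (closedBall 0 R ×ˢ (closedBall 0 R ×ˢ closedBall 0 R)) with hK₂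
  have hK₂c : IsCompact K₂ :=
    hZc.prod ((isCompact_closedBall 0 R).prod ((isCompact_closedBall 0 R).prod
      (isCompact_closedBall 0 R)))
  have hK₂conv : Convex ℝ K₂ :=
    hZconv.prod ((convex_closedBall 0 R).prod ((convex_closedBall 0 R).prod (convex_closedBall 0 R)))
  obtain ⟨C₂', hC₂'⟩ := hK₂c.exists_bound_of_continuousOn
    ((h𝔑.continuous_fderiv (by simp)).norm).continuousOn
  set C₂ := max C₂' 0 with hC₂def
  have hC₂ : 0 ≤ C₂ := le_max_right _ _
  have h𝔑b : ∀ q ∈ K₂, ‖fderiv ℝ 𝔑 q‖ ≤ C₂ := fun q hq ↦ by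
    have h := hC₂' q hq
    rw [norm_norm] at h
    exact h.trans (le_max_left _ _)
  -- bound `D` for the second derivatives of `u₂` on `Z`
  set Θ : Pt d → ℝ := fun p ↦ ‖dTT u₂ p‖ + ∑ i, ‖dTX u₂ i p‖ + ∑ i, ∑ j, ‖dXX u₂ i j p‖ with hΘ
  have hΘc : Continuous Θ :=
    ((contDiff_fderiv_apply (contDiff_dT hu₂) _).continuous.norm.add
      (continuous_finsetSum _ fun i _ ↦
        (contDiff_fderiv_apply (contDiff_dT hu₂) _).continuous.norm)).add
      (continuous_finsetSum _ fun i _ ↦ continuous_finsetSum _ fun j _ ↦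
        (contDiff_fderiv_apply (contDiff_dX hu₂ j) _).continuous.norm)
  obtain ⟨D', hD'⟩ := hZc.exists_bound_of_continuousOn hΘc.continuousOn
  set D := max D' 0 with hDdef
  have hD : 0 ≤ D := le_max_right _ _
  have hΘle : ∀ p ∈ Z, Θ p ≤ D := fun p hp ↦ by
    have h := hD' p hp
    rw [Real.norm_of_nonneg (by positivity)] at h
    exact h.trans (le_max_left _ _)
  -- the difference and its differential inequality
  set w : Pt d → F := u₁ - u₂ with hw
  have hws : ContDiff ℝ ∞ w := hu₁.sub hu₂
  set L : ℝ := C₂ + 4 * C * D with hL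
  have hP : ∀ p ∈ Z, ‖op w a₁ b₁ G₁ p‖ ≤ L * (‖w p‖ + ‖dT w p‖ + ∑ i, ‖dX w i p‖) := by
    intro p hp
    obtain ⟨hu₁R, hu₂R, hT₁R, hT₂R, hX₁R, hX₂R⟩ := hjet p hp
    have hwT : dT w p = dT u₁ p - dT u₂ p := dT_sub hu₁ hu₂ p
    have hwX : ∀ i, dX w i p = dX u₁ i p - dX u₂ i p := fun i ↦ dX_sub hu₁ hu₂ i p
    set J : ℝ := ‖w p‖ + ‖dT w p‖ + ∑ i, ‖dX w i p‖ with hJ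
    have hJ0 : 0 ≤ J := by positivity
    have hwJ : ‖w p‖ ≤ J := by
      have := norm_nonneg (dT w p); have : 0 ≤ ∑ i, ‖dX w i p‖ := by positivity
      linarith
    -- the algebra: `P₁ w = (𝔑₁ − 𝔑₂) − (P₁ u₂ − P₂ u₂)`
    have halg : op w a₁ b₁ G₁ p =
        (𝔑 (p, u₁ p, dT u₁ p, fun i ↦ dX u₁ i p) - 𝔑 (p, u₂ p, dT u₂ p, fun i ↦ dX u₂ i p)) -
          (op u₂ a₁ b₁ G₁ p - op u₂ a₂ b₂ G₂ p) := by
      rw [hw, op_sub hu₁ hu₂, h₁ p hp, ← h₂ p hp]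
      abel
    -- the Lipschitz estimates
    have hmem₁ : (p, u₁ p) ∈ K₁ := ⟨hp, mem_closedBall_zero_iff.2 hu₁R⟩
    have hmem₂ : (p, u₂ p) ∈ K₁ := ⟨hp, mem_closedBall_zero_iff.2 hu₂R⟩
    have hdist : ‖((p, u₁ p) : Pt d × F) - (p, u₂ p)‖ = ‖w p‖ := by
      rw [Prod.mk_sub_mk, sub_self, norm_zero_prod]; rfl
    have hlip : ∀ {f : Pt d × F → ℝ}, ContDiff ℝ ∞ f → (∀ q ∈ K₁, ‖fderiv ℝ f q‖ ≤ C) →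
        |f (p, u₁ p) - f (p, u₂ p)| ≤ C * ‖w p‖ := fun hf hb ↦ by
      rw [← Real.norm_eq_abs, ← hdist]
      exact hK₁conv.norm_image_sub_le_of_norm_fderiv_le
        (fun q _ ↦ (hf.differentiable hsm) q) hb hmem₂ hmem₁
    have hda : |a₁ p - a₂ p| ≤ C * ‖w p‖ := hlip h𝔞 hCa'
    have hdb : ∀ i, |b₁ i p - b₂ i p| ≤ C * ‖w p‖ := fun i ↦ hlip (h𝔟 i) (hCb' i)
    have hdG : ∀ i j, |G₁ i j p - G₂ i j p| ≤ C * ‖w p‖ := fun i j ↦ hlip (h𝔊 i j) (hCG' i j)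
    have hXnorm : ∀ {u : Pt d → F}, (∀ i, ‖dX u i p‖ ≤ R) →
        (fun i ↦ dX u i p) ∈ closedBall (0 : Fin d → F) R := fun h ↦ by
      rw [mem_closedBall_zero_iff]
      exact (pi_norm_le_iff_of_nonneg (le_max_right _ _)).2 h
    have hmemN₁ : (p, u₁ p, dT u₁ p, fun i ↦ dX u₁ i p) ∈ K₂ :=
      ⟨hp, mem_closedBall_zero_iff.2 hu₁R, mem_closedBall_zero_iff.2 hT₁R, hXnorm hX₁R⟩
    have hmemN₂ : (p, u₂ p, dT u₂ p, fun i ↦ dX u₂ i p) ∈ K₂ :=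
      ⟨hp, mem_closedBall_zero_iff.2 hu₂R, mem_closedBall_zero_iff.2 hT₂R, hXnorm hX₂R⟩
    have hdN : ‖𝔑 (p, u₁ p, dT u₁ p, fun i ↦ dX u₁ i p) - 𝔑 (p, u₂ p, dT u₂ p, fun i ↦ dX u₂ i p)‖ ≤
        C₂ * J := by
      have h := hK₂conv.norm_image_sub_le_of_norm_fderiv_le
        (fun q _ ↦ (h𝔑.differentiable hsm) q) h𝔑b hmemN₂ hmemN₁
      refine h.trans (mul_le_mul_of_nonneg_left ?_ hC₂)
      have hXeq : ((fun i ↦ dX u₁ i p) - fun i ↦ dX u₂ i p) = fun i ↦ dX w i p := by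
        funext i; simp only [Pi.sub_apply, hwX i]
      have hwp : w p = u₁ p - u₂ p := rfl
      have heq : ((p, u₁ p, dT u₁ p, fun i ↦ dX u₁ i p) : Pt d × F × F × (Fin d → F)) -
          (p, u₂ p, dT u₂ p, fun i ↦ dX u₂ i p) = ((0 : Pt d), w p, dT w p, fun i ↦ dX w i p) := by
        simp only [Prod.mk_sub_mk, sub_self, hXeq, ← hwT, ← hwp]
      rw [heq]
      exact norm_zero_prod_le _ _ _
    -- the coefficient term
    have hΘp := hΘle p hp
    have hTTle : ‖dTT u₂ p‖ ≤ D := by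
      have h1 : 0 ≤ ∑ i, ‖dTX u₂ i p‖ := by positivity
      have h2 : 0 ≤ ∑ i, ∑ j, ‖dXX u₂ i j p‖ := by positivity
      simp only [hΘ] at hΘp; linarith
    have hTXle : ∑ i, ‖dTX u₂ i p‖ ≤ D := by
      have h1 := norm_nonneg (dTT u₂ p)
      have h2 : 0 ≤ ∑ i, ∑ j, ‖dXX u₂ i j p‖ := by positivity
      simp only [hΘ] at hΘp; linarith
    have hXXle : ∑ i, ∑ j, ‖dXX u₂ i j p‖ ≤ D := by
      have h1 := norm_nonneg (dTT u₂ p)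
      have h2 : 0 ≤ ∑ i, ‖dTX u₂ i p‖ := by positivity
      simp only [hΘ] at hΘp; linarith
    have hcoefTerm : ‖op u₂ a₁ b₁ G₁ p - op u₂ a₂ b₂ G₂ p‖ ≤ 4 * C * D * ‖w p‖ := by
      rw [op_sub_op]
      have t1 : ‖(a₁ p - a₂ p) • dTT u₂ p‖ ≤ C * ‖w p‖ * D := by
        rw [norm_smul, Real.norm_eq_abs]
        exact mul_le_mul hda hTTle (norm_nonneg _) (by positivity)
      have t2 : ‖(2 : ℝ) • ∑ i, (b₁ i p - b₂ i p) • dTX u₂ i p‖ ≤ 2 * (C * ‖w p‖ * D) := by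
        rw [norm_smul, Real.norm_eq_abs, abs_two]
        refine mul_le_mul_of_nonneg_left ?_ zero_le_two
        refine (norm_sum_le _ _).trans ?_
        calc ∑ i, ‖(b₁ i p - b₂ i p) • dTX u₂ i p‖ ≤ ∑ i, C * ‖w p‖ * ‖dTX u₂ i p‖ :=
              Finset.sum_le_sum fun i _ ↦ by
                rw [norm_smul, Real.norm_eq_abs]
                exact mul_le_mul_of_nonneg_right (hdb i) (norm_nonneg _)
          _ = C * ‖w p‖ * ∑ i, ‖dTX u₂ i p‖ := by rw [Finset.mul_sum]
          _ ≤ C * ‖w p‖ * D := mul_le_mul_of_nonneg_left hTXle (by positivity)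
      have t3 : ‖∑ i, ∑ j, (G₁ i j p - G₂ i j p) • dXX u₂ i j p‖ ≤ C * ‖w p‖ * D := by
        refine (norm_sum_le _ _).trans ?_
        calc ∑ i, ‖∑ j, (G₁ i j p - G₂ i j p) • dXX u₂ i j p‖
            ≤ ∑ i, ∑ j, C * ‖w p‖ * ‖dXX u₂ i j p‖ := Finset.sum_le_sum fun i _ ↦
              (norm_sum_le _ _).trans (Finset.sum_le_sum fun j _ ↦ by
                rw [norm_smul, Real.norm_eq_abs]
                exact mul_le_mul_of_nonneg_right (hdG i j) (norm_nonneg _))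
          _ = C * ‖w p‖ * ∑ i, ∑ j, ‖dXX u₂ i j p‖ := by
              rw [Finset.mul_sum]
              exact Finset.sum_congr rfl fun i _ ↦ by rw [Finset.mul_sum]
          _ ≤ C * ‖w p‖ * D := mul_le_mul_of_nonneg_left hXXle (by positivity)
      calc ‖(a₁ p - a₂ p) • dTT u₂ p - (2 : ℝ) • ∑ i, (b₁ i p - b₂ i p) • dTX u₂ i p -
              ∑ i, ∑ j, (G₁ i j p - G₂ i j p) • dXX u₂ i j p‖
          ≤ C * ‖w p‖ * D + 2 * (C * ‖w p‖ * D) + C * ‖w p‖ * D :=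
            (norm_sub_le _ _).trans (add_le_add ((norm_sub_le _ _).trans (add_le_add t1 t2)) t3)
        _ = 4 * C * D * ‖w p‖ := by ring
    -- conclusion
    calc ‖op w a₁ b₁ G₁ p‖ ≤ C₂ * J + 4 * C * D * ‖w p‖ := by
          rw [halg]
          exact (norm_sub_le _ _).trans (add_le_add hdN hcoefTerm)
      _ ≤ C₂ * J + 4 * C * D * J := by
          gcongr
      _ = L * J := by rw [hL]; ring
  -- the data of the difference vanish
  have h0w : ∀ y ∈ closedBall x₁ ρ, w (0, y) = 0 := fun y hy ↦ by
    show u₁ (0, y) - u₂ (0, y) = 0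
    rw [h0 y hy, sub_self]
  have h1w : ∀ y ∈ closedBall x₁ ρ, dT w (0, y) = 0 := fun y hy ↦ by
    rw [hw, dT_sub hu₁ hu₂, h1 y hy, sub_self]
  have h := H L w hws hP h0w h1w t ht x hx
  exact sub_eq_zero.1 h

end Quasilinear

/-! ### Time reflection -/

section Reflect

/-- Time reflection `(t, x) ↦ (−t, x)` as a continuous linear map. [folklore] -/
def timeReflect : Pt d →L[ℝ] Pt d :=
  (-(ContinuousLinearMap.fst ℝ ℝ (EuclideanSpace ℝ (Fin d)))).prod
    (ContinuousLinearMap.snd ℝ ℝ (EuclideanSpace ℝ (Fin d)))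

/-- `timeReflect (t, x) = (−t, x)`. [folklore] -/
@[simp] theorem timeReflect_apply (p : Pt d) : timeReflect p = (-p.1, p.2) := rfl

/-- `timeReflect eT = −eT`. [folklore] -/
theorem timeReflect_eT : timeReflect (eT : Pt d) = -eT := by
  rw [timeReflect_apply]; ext <;> simp

/-- `timeReflect (eX i) = eX i`. [folklore] -/
theorem timeReflect_eX (i : Fin d) : timeReflect (eX i : Pt d) = eX i := by
  rw [timeReflect_apply]; ext <;> simp

variable {u : Pt d → F}

omit [InnerProductSpace ℝ F] in
/-- Chain rule through the time reflection. [folklore] -/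
theorem fderiv_comp_timeReflect [NormedSpace ℝ F] {u : Pt d → F} (hu : Differentiable ℝ u)
    (p v : Pt d) : fderiv ℝ (u ∘ timeReflect) p v = fderiv ℝ u (timeReflect p) (timeReflect v) := by
  rw [fderiv_comp p (hu _) (timeReflect (d := d)).differentiableAt, ContinuousLinearMap.fderiv]
  rfl

/-- `(u ∘ σ)_t = −u_t ∘ σ`. [folklore] -/
theorem dT_comp_timeReflect (hu : ContDiff ℝ ∞ u) (p : Pt d) :
    dT (u ∘ timeReflect) p = -dT u (timeReflect p) := by
  unfold dT
  rw [fderiv_comp_timeReflect (hu.differentiable (by simp)), timeReflect_eT, map_neg]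

/-- `(u ∘ σ)_i = u_i ∘ σ`. [folklore] -/
theorem dX_comp_timeReflect (hu : ContDiff ℝ ∞ u) (i : Fin d) (p : Pt d) :
    dX (u ∘ timeReflect) i p = dX u i (timeReflect p) := by
  unfold dX
  rw [fderiv_comp_timeReflect (hu.differentiable (by simp)), timeReflect_eX]

/-- `(u ∘ σ)_t = −u_t ∘ σ` as functions. [folklore] -/
theorem dT_comp_timeReflect_eq (hu : ContDiff ℝ ∞ u) :
    dT (u ∘ timeReflect) = -(dT u ∘ timeReflect) := funext fun p ↦ dT_comp_timeReflect hu p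

/-- `(u ∘ σ)_i = u_i ∘ σ` as functions. [folklore] -/
theorem dX_comp_timeReflect_eq (hu : ContDiff ℝ ∞ u) (i : Fin d) :
    dX (u ∘ timeReflect) i = dX u i ∘ timeReflect := funext fun p ↦ dX_comp_timeReflect hu i p

/-- `(u ∘ σ)_tt = u_tt ∘ σ`. [folklore] -/
theorem dTT_comp_timeReflect (hu : ContDiff ℝ ∞ u) (p : Pt d) :
    dTT (u ∘ timeReflect) p = dTT u (timeReflect p) := by
  unfold dTT
  rw [dT_comp_timeReflect_eq hu, fderiv_neg, _root_.neg_apply,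
    fderiv_comp_timeReflect ((contDiff_dT hu).differentiable (by simp)), timeReflect_eT, map_neg,
    neg_neg]

/-- `(u ∘ σ)_ti = −u_ti ∘ σ`. [folklore] -/
theorem dTX_comp_timeReflect (hu : ContDiff ℝ ∞ u) (i : Fin d) (p : Pt d) :
    dTX (u ∘ timeReflect) i p = -dTX u i (timeReflect p) := by
  unfold dTX
  rw [dT_comp_timeReflect_eq hu, fderiv_neg, _root_.neg_apply,
    fderiv_comp_timeReflect ((contDiff_dT hu).differentiable (by simp)), timeReflect_eX]

/-- `(u ∘ σ)_ij = u_ij ∘ σ`. [folklore] -/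
theorem dXX_comp_timeReflect (hu : ContDiff ℝ ∞ u) (i j : Fin d) (p : Pt d) :
    dXX (u ∘ timeReflect) i j p = dXX u i j (timeReflect p) := by
  unfold dXX
  rw [dX_comp_timeReflect_eq hu, fderiv_comp_timeReflect ((contDiff_dX hu j).differentiable (by simp)),
    timeReflect_eX]

/-- The operator under time reflection: `P_{a∘σ, −b∘σ, G∘σ} (u ∘ σ) = (P_{a,b,G} u) ∘ σ`.
[folklore] -/
theorem op_comp_timeReflect (hu : ContDiff ℝ ∞ u) (a : Pt d → ℝ) (b : Fin d → Pt d → ℝ)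
    (G : Fin d → Fin d → Pt d → ℝ) (p : Pt d) :
    op (u ∘ timeReflect) (fun q ↦ a (timeReflect q)) (fun i q ↦ -b i (timeReflect q))
        (fun i j q ↦ G i j (timeReflect q)) p =
      op u a b G (timeReflect p) := by
  unfold op
  simp only [dTT_comp_timeReflect hu, dTX_comp_timeReflect hu, dXX_comp_timeReflect hu, smul_neg,
    neg_smul, neg_neg]

/-- `u ∘ σ` is smooth. [folklore] -/
theorem contDiff_comp_timeReflect (hu : ContDiff ℝ ∞ u) : ContDiff ℝ ∞ (u ∘ timeReflect) :=
  hu.comp (timeReflect (d := d)).contDiff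

end Reflect

/-! ### Two-sided version: agreement on a neighbourhood of the base point -/

section TwoSided

variable [FiniteDimensional ℝ F]

/-- **Local uniqueness for quasilinear diagonal second-order hyperbolic systems, two-sided.** In the
setting of `exists_slope_eq_of_quasilinear`, with the equations, the hyperbolicity along `u₁` and
the equality of the Cauchy data holding on the two-sided cylinder `[−T, T] × B̄(x₁, ρ)`
(`T, ρ > 0`), the two solutions agree on a neighbourhood of `(0, x₁)` (the forward cone and, by
time reflection `t ↦ −t` — which maps solutions to solutions of the reflected system
`(𝔞∘σ, −𝔟∘σ, 𝔊∘σ, 𝔑(σ·, ·, −·, ·))` — the backward cone).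
[cite: HawkingEllis1973CUP, §7.5, Prop. 7.5.1 (uniqueness) and p. 249 ("Similarly one can obtain a
solution on 𝒰₋")] -/
theorem eventually_eq_of_quasilinear
    {𝔞 : Pt d × F → ℝ} {𝔟 : Fin d → Pt d × F → ℝ} {𝔊 : Fin d → Fin d → Pt d × F → ℝ}
    {𝔑 : Pt d × F × F × (Fin d → F) → F}
    (h𝔞 : ContDiff ℝ ∞ 𝔞) (h𝔟 : ∀ i, ContDiff ℝ ∞ (𝔟 i)) (h𝔊 : ∀ i j, ContDiff ℝ ∞ (𝔊 i j))
    (h𝔊s : ∀ i j q, 𝔊 i j q = 𝔊 j i q) (h𝔑 : ContDiff ℝ ∞ 𝔑)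
    {T ρ lam : ℝ} {x₁ : EuclideanSpace ℝ (Fin d)} (hT : 0 < T) (hρ : 0 < ρ) (hlam : 0 < lam)
    {u₁ u₂ : Pt d → F} (hu₁ : ContDiff ℝ ∞ u₁) (hu₂ : ContDiff ℝ ∞ u₂)
    (hapos : ∀ p ∈ Icc (-T) T ×ˢ closedBall x₁ ρ, lam ≤ 𝔞 (p, u₁ p))
    (hGpos : ∀ p ∈ Icc (-T) T ×ˢ closedBall x₁ ρ, ∀ X : Fin d → F,
      lam * ∑ i, ‖X i‖ ^ 2 ≤ ∑ i, ∑ j, 𝔊 i j (p, u₁ p) * ⟪X i, X j⟫)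
    (h₁ : ∀ p ∈ Icc (-T) T ×ˢ closedBall x₁ ρ,
      op u₁ (fun q ↦ 𝔞 (q, u₁ q)) (fun i q ↦ 𝔟 i (q, u₁ q)) (fun i j q ↦ 𝔊 i j (q, u₁ q)) p =
        𝔑 (p, u₁ p, dT u₁ p, fun i ↦ dX u₁ i p))
    (h₂ : ∀ p ∈ Icc (-T) T ×ˢ closedBall x₁ ρ,
      op u₂ (fun q ↦ 𝔞 (q, u₂ q)) (fun i q ↦ 𝔟 i (q, u₂ q)) (fun i j q ↦ 𝔊 i j (q, u₂ q)) p =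
        𝔑 (p, u₂ p, dT u₂ p, fun i ↦ dX u₂ i p))
    (h0 : ∀ x ∈ closedBall x₁ ρ, u₁ (0, x) = u₂ (0, x))
    (h1 : ∀ x ∈ closedBall x₁ ρ, dT u₁ (0, x) = dT u₂ (0, x)) :
    ∀ᶠ p in 𝓝 ((0 : ℝ), x₁), u₁ p = u₂ p := by
  have hsubf : Icc 0 T ×ˢ closedBall x₁ ρ ⊆ Icc (-T) T ×ˢ closedBall x₁ ρ :=
    prod_mono (Icc_subset_Icc (by linarith) le_rfl) Subset.rfl
  -- forward cone
  obtain ⟨cf, hcf, Hf⟩ := exists_slope_eq_of_quasilinear h𝔞 h𝔟 h𝔊 h𝔊s h𝔑 hlam hu₁ hu₂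
    (fun p hp ↦ hapos p (hsubf hp)) (fun p hp ↦ hGpos p (hsubf hp)) (fun p hp ↦ h₁ p (hsubf hp))
    (fun p hp ↦ h₂ p (hsubf hp)) h0 h1
  -- backward cone: reflect
  have hσmem : ∀ p ∈ Icc 0 T ×ˢ closedBall x₁ ρ, timeReflect p ∈ Icc (-T) T ×ˢ closedBall x₁ ρ := by
    rintro ⟨t, y⟩ ⟨⟨ht0, htT⟩, hy⟩
    exact ⟨⟨by simp only [timeReflect_apply]; linarith,
      by simp only [timeReflect_apply]; linarith⟩, hy⟩
  set 𝔞' : Pt d × F → ℝ := fun q ↦ 𝔞 (timeReflect q.1, q.2) with h𝔞'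
  set 𝔟' : Fin d → Pt d × F → ℝ := fun i q ↦ -𝔟 i (timeReflect q.1, q.2) with h𝔟'
  set 𝔊' : Fin d → Fin d → Pt d × F → ℝ := fun i j q ↦ 𝔊 i j (timeReflect q.1, q.2) with h𝔊'
  set 𝔑' : Pt d × F × F × (Fin d → F) → F := fun q ↦ 𝔑 (timeReflect q.1, q.2.1, -q.2.2.1, q.2.2.2) with h𝔑'
  have hρ₁ : ContDiff ℝ ∞ fun q : Pt d × F ↦ ((timeReflect q.1, q.2) : Pt d × F) :=
    ((timeReflect (d := d)).contDiff.comp contDiff_fst).prodMk contDiff_snd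
  have h𝔞's : ContDiff ℝ ∞ 𝔞' := h𝔞.comp hρ₁
  have h𝔟's : ∀ i, ContDiff ℝ ∞ (𝔟' i) := fun i ↦ ((h𝔟 i).comp hρ₁).neg
  have h𝔊's : ∀ i j, ContDiff ℝ ∞ (𝔊' i j) := fun i j ↦ (h𝔊 i j).comp hρ₁
  have hρ₂ : ContDiff ℝ ∞ fun q : Pt d × F × F × (Fin d → F) ↦
      ((timeReflect q.1, q.2.1, -q.2.2.1, q.2.2.2) : Pt d × F × F × (Fin d → F)) :=
    ((timeReflect (d := d)).contDiff.comp contDiff_fst).prodMk ((contDiff_fst.comp contDiff_snd).prodMk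
      (((contDiff_fst.comp (contDiff_snd.comp contDiff_snd)).neg).prodMk
        (contDiff_snd.comp (contDiff_snd.comp contDiff_snd))))
  have h𝔑's : ContDiff ℝ ∞ 𝔑' := h𝔑.comp hρ₂
  have hv₁ := contDiff_comp_timeReflect hu₁
  have hv₂ := contDiff_comp_timeReflect hu₂
  have hsol : ∀ {u : Pt d → F}, ContDiff ℝ ∞ u →
      (∀ p ∈ Icc (-T) T ×ˢ closedBall x₁ ρ,
        op u (fun q ↦ 𝔞 (q, u q)) (fun i q ↦ 𝔟 i (q, u q)) (fun i j q ↦ 𝔊 i j (q, u q)) p =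
          𝔑 (p, u p, dT u p, fun i ↦ dX u i p)) →
      ∀ p ∈ Icc 0 T ×ˢ closedBall x₁ ρ,
        op (u ∘ timeReflect) (fun q ↦ 𝔞' (q, (u ∘ timeReflect) q)) (fun i q ↦ 𝔟' i (q, (u ∘ timeReflect) q))
            (fun i j q ↦ 𝔊' i j (q, (u ∘ timeReflect) q)) p =
          𝔑' (p, (u ∘ timeReflect) p, dT (u ∘ timeReflect) p, fun i ↦ dX (u ∘ timeReflect) i p) := by
    intro u hu hsolu p hp
    have h := op_comp_timeReflect hu (fun q ↦ 𝔞 (q, u q)) (fun i q ↦ 𝔟 i (q, u q))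
      (fun i j q ↦ 𝔊 i j (q, u q)) p
    rw [hsolu (timeReflect p) (hσmem p hp)] at h
    simp only [h𝔞', h𝔟', h𝔊', h𝔑', dT_comp_timeReflect hu, dX_comp_timeReflect hu, neg_neg,
      Function.comp_apply] at h ⊢
    exact h
  obtain ⟨cb, hcb, Hb⟩ := exists_slope_eq_of_quasilinear (u₁ := u₁ ∘ timeReflect) (u₂ := u₂ ∘ timeReflect)
    h𝔞's h𝔟's h𝔊's (fun i j q ↦ h𝔊s i j _) h𝔑's hlam hv₁ hv₂
    (fun p hp ↦ hapos (timeReflect p) (hσmem p hp)) (fun p hp X ↦ hGpos (timeReflect p) (hσmem p hp) X)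
    (hsol hu₁ h₁) (hsol hu₂ h₂)
    (fun y hy ↦ by simp only [Function.comp_apply, timeReflect_apply, neg_zero]; exact h0 y hy)
    (fun y hy ↦ by
      rw [dT_comp_timeReflect hu₁, dT_comp_timeReflect hu₂]
      simp only [timeReflect_apply, neg_zero]
      rw [h1 y hy])
  -- the neighbourhood
  set c := max cf cb with hc
  have hcpos : 0 < c := lt_max_of_lt_left hcf
  set ε := min T (ρ / (2 * c)) with hε
  have hεpos : 0 < ε := lt_min hT (by positivity)
  set N : Set (Pt d) := {p | |p.1| < ε ∧ dist p.2 x₁ < ρ / 2} with hN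
  have hNo : IsOpen N :=
    (isOpen_lt (continuous_abs.comp continuous_fst) continuous_const).inter
      (isOpen_lt (continuous_snd.dist continuous_const) continuous_const)
  have hNmem : ((0 : ℝ), x₁) ∈ N := ⟨by simpa using hεpos, by simp; positivity⟩
  filter_upwards [hNo.mem_nhds hNmem] with p hp
  obtain ⟨hp1, hp2⟩ := hp
  have hεT : ε ≤ T := min_le_left _ _
  have hεc : c * ε ≤ ρ / 2 := by
    have h := min_le_right T (ρ / (2 * c))
    rw [← hε] at h
    calc c * ε ≤ c * (ρ / (2 * c)) := mul_le_mul_of_nonneg_left h hcpos.le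
      _ = ρ / 2 := by field_simp
  rcases le_or_gt 0 p.1 with ht | ht
  · -- forward
    have hlt : p.1 < ε := (abs_lt.1 hp1).2
    have hdist : dist p.2 x₁ < ρ - cf * p.1 := by
      have : cf * p.1 ≤ c * ε :=
        (mul_le_mul_of_nonneg_right (le_max_left _ _) ht).trans
          (mul_le_mul_of_nonneg_left hlt.le hcpos.le)
      linarith
    exact Hf p.1 ⟨ht, by linarith⟩ p.2 hdist
  · -- backward
    have hlt : -p.1 < ε := (abs_lt.1 hp1).1 |> fun h ↦ by linarith
    have hdist : dist p.2 x₁ < ρ - cb * (-p.1) := by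
      have : cb * (-p.1) ≤ c * ε :=
        (mul_le_mul_of_nonneg_right (le_max_right _ _) (by linarith)).trans
          (mul_le_mul_of_nonneg_left hlt.le hcpos.le)
      linarith
    have h := Hb (-p.1) ⟨by linarith, by linarith⟩ p.2 hdist
    simpa using h

end TwoSided

/-! ### Congruence of jets and cut-offs -/

section Congr

variable {u v : Pt d → F} {S : Set (Pt d)}

/-- Jets are local: `u = v` on an open set `S` gives `u_t = v_t` on `S`. [folklore] -/
theorem dT_congr (hS : IsOpen S) (h : EqOn u v S) {p : Pt d} (hp : p ∈ S) : dT u p = dT v p := by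
  unfold dT
  rw [(Filter.eventuallyEq_of_mem (hS.mem_nhds hp) h).fderiv_eq]

/-- `u = v` on an open `S` gives `u_i = v_i` on `S`. [folklore] -/
theorem dX_congr (hS : IsOpen S) (h : EqOn u v S) (i : Fin d) {p : Pt d} (hp : p ∈ S) :
    dX u i p = dX v i p := by
  unfold dX
  rw [(Filter.eventuallyEq_of_mem (hS.mem_nhds hp) h).fderiv_eq]

/-- `u = v` on an open `S` gives `u_tt = v_tt` on `S`. [folklore] -/
theorem dTT_congr (hS : IsOpen S) (h : EqOn u v S) {p : Pt d} (hp : p ∈ S) : dTT u p = dTT v p := by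
  unfold dTT
  rw [(Filter.eventuallyEq_of_mem (hS.mem_nhds hp) fun q hq ↦ dT_congr hS h hq).fderiv_eq]

/-- `u = v` on an open `S` gives `u_ti = v_ti` on `S`. [folklore] -/
theorem dTX_congr (hS : IsOpen S) (h : EqOn u v S) (i : Fin d) {p : Pt d} (hp : p ∈ S) :
    dTX u i p = dTX v i p := by
  unfold dTX
  rw [(Filter.eventuallyEq_of_mem (hS.mem_nhds hp) fun q hq ↦ dT_congr hS h hq).fderiv_eq]

/-- `u = v` on an open `S` gives `u_ij = v_ij` on `S`. [folklore] -/
theorem dXX_congr (hS : IsOpen S) (h : EqOn u v S) (i j : Fin d) {p : Pt d} (hp : p ∈ S) :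
    dXX u i j p = dXX v i j p := by
  unfold dXX
  rw [(Filter.eventuallyEq_of_mem (hS.mem_nhds hp) fun q hq ↦ dX_congr hS h j hq).fderiv_eq]

/-- `u = v` on an open `S` gives `P u = P v` on `S`. [folklore] -/
theorem op_congr (hS : IsOpen S) (h : EqOn u v S) (a : Pt d → ℝ) (b : Fin d → Pt d → ℝ)
    (G : Fin d → Fin d → Pt d → ℝ) {p : Pt d} (hp : p ∈ S) : op u a b G p = op v a b G p := by
  unfold op
  simp only [dTT_congr hS h hp, dTX_congr hS h _ hp, dXX_congr hS h _ _ hp]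

/-- `P u` at `p` only depends on the values of the coefficients at `p`. [folklore] -/
theorem op_coef_congr (u : Pt d → F) {a a' : Pt d → ℝ} {b b' : Fin d → Pt d → ℝ}
    {G G' : Fin d → Fin d → Pt d → ℝ} {p : Pt d} (ha : a p = a' p) (hb : ∀ i, b i p = b' i p)
    (hG : ∀ i j, G i j p = G' i j p) : op u a b G p = op u a' b' G' p := by
  unfold op
  simp only [ha, hb, hG]

end Congr

section Cutoff

variable {P V : Type*} [NormedAddCommGroup P] [NormedSpace ℝ P] [HasContDiffBump P]
  [NormedAddCommGroup V] [NormedSpace ℝ V]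

/-- **Cut-off**: a function smooth on an open set containing the support ball of a bump function
becomes globally smooth after multiplication by the bump. [folklore] -/
theorem contDiff_bump_smul {c : P} (φ : ContDiffBump c) {U : Set P} (hU : IsOpen U)
    (hsub : closedBall c φ.rOut ⊆ U) {f : P → V} (hf : ContDiffOn ℝ ∞ f U) :
    ContDiff ℝ ∞ fun x ↦ φ x • f x := by
  refine contDiff_iff_contDiffAt.2 fun x ↦ ?_
  by_cases hx : x ∈ U
  · exact φ.contDiff.contDiffAt.smul (hf.contDiffAt (hU.mem_nhds hx))
  · have hd : φ.rOut < dist x c := by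
      by_contra h
      exact hx (hsub (mem_closedBall.2 (not_lt.1 h)))
    have hev : (fun y ↦ φ y • f y) =ᶠ[𝓝 x] fun _ ↦ 0 := by
      filter_upwards [(isOpen_lt continuous_const (continuous_id.dist continuous_const)).mem_nhds hd]
        with y hy
      have hy' : φ.rOut ≤ dist y c := le_of_lt hy
      rw [φ.zero_of_le_dist hy', zero_smul]
    exact contDiffAt_const.congr_of_eventuallyEq hev

/-- The cut-off function agrees with the original on the inner ball. [folklore] -/
theorem eqOn_bump_smul {c : P} (φ : ContDiffBump c) (f : P → V) :
    EqOn (fun x ↦ φ x • f x) f (ball c φ.rIn) := fun x hx ↦ by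
  show φ x • f x = f x
  rw [φ.one_of_mem_closedBall (ball_subset_closedBall hx), one_smul]

end Cutoff

/-! ### Germ version: coefficients and solutions given only near the base point -/

section Germ

variable [FiniteDimensional ℝ F]

omit [FiniteDimensional ℝ F] in
/-- `u_i(0, y)` for `y` near `x₁` only depends on the datum `u(0, ·)` near `x₁`. [folklore] -/
theorem dX_eq_of_data_eventuallyEq {u v : Pt d → F} (hu : ContDiff ℝ ∞ u) (hv : ContDiff ℝ ∞ v)
    {x₁ : EuclideanSpace ℝ (Fin d)} (h : ∀ᶠ y in 𝓝 x₁, u (0, y) = v (0, y)) (i : Fin d) :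
    dX u i (0, x₁) = dX v i (0, x₁) := by
  obtain ⟨r, hr, hball⟩ := Metric.mem_nhds_iff.1 h
  have h0 : ∀ y ∈ closedBall x₁ (r / 2), (u - v) (0, y) = 0 := fun y hy ↦ by
    have := hball (closedBall_subset_ball (by linarith) hy)
    simpa [sub_eq_zero] using this
  have hs : ContDiff ℝ ∞ (u - v) := hu.sub hv
  have h1 := dX_zero_of_data hs (by positivity : 0 < r / 2) h0 i
    (mem_closedBall_self (by positivity))
  rwa [dX_sub hu hv, sub_eq_zero] at h1

/-- **Local uniqueness for quasilinear diagonal second-order hyperbolic systems, germ form.**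
Coefficients `𝔞, 𝔟ⁱ, 𝔊ⁱʲ = 𝔊ʲⁱ` smooth on an open set `Ω₁ ∋ ((0, x₁), u₁(0, x₁))`, right-hand side
`𝔑` smooth on an open `Ω₂` containing the `1`-jet of `u₁` at `(0, x₁)`, two solutions `u₁, u₂`
smooth near `(0, x₁)` of `𝔞(p,u) u_tt − 2 ∑ 𝔟ⁱ(p,u) u_ti − ∑ 𝔊ⁱʲ(p,u) u_ij = 𝔑(p, u, u_t, ∇u)`
near `(0, x₁)`, the operator hyperbolic at the base jet (`𝔞 > 0`, `𝔊 ≥ λ > 0` there), with the same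
Cauchy data near `x₁`: then `u₁ = u₂` near `(0, x₁)`. (Reduction to `eventually_eq_of_quasilinear`
by smooth cut-offs of the solutions and of the coefficients and a small two-sided cylinder chosen
by continuity.) [cite: HawkingEllis1973CUP, §7.5, Prop. 7.5.1 (uniqueness), p. 249]
[cite: John1982, Ch. 5 §3] -/
theorem eventually_eq_of_quasilinear_germ
    {𝔞 : Pt d × F → ℝ} {𝔟 : Fin d → Pt d × F → ℝ} {𝔊 : Fin d → Fin d → Pt d × F → ℝ}
    {𝔑 : Pt d × F × F × (Fin d → F) → F} {Ω₁ : Set (Pt d × F)}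
    {Ω₂ : Set (Pt d × F × F × (Fin d → F))} (hΩ₁ : IsOpen Ω₁) (hΩ₂ : IsOpen Ω₂)
    (h𝔞 : ContDiffOn ℝ ∞ 𝔞 Ω₁) (h𝔟 : ∀ i, ContDiffOn ℝ ∞ (𝔟 i) Ω₁)
    (h𝔊 : ∀ i j, ContDiffOn ℝ ∞ (𝔊 i j) Ω₁) (h𝔊s : ∀ i j q, 𝔊 i j q = 𝔊 j i q)
    (h𝔑 : ContDiffOn ℝ ∞ 𝔑 Ω₂) {x₁ : EuclideanSpace ℝ (Fin d)} {U : Set (Pt d)}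
    (hU : U ∈ 𝓝 ((0 : ℝ), x₁)) {u₁ u₂ : Pt d → F} (hu₁ : ContDiffOn ℝ ∞ u₁ U)
    (hu₂ : ContDiffOn ℝ ∞ u₂ U) (hm₁ : (((0 : ℝ), x₁), u₁ (0, x₁)) ∈ Ω₁)
    (hm₂ : (((0 : ℝ), x₁), u₁ (0, x₁), dT u₁ (0, x₁), fun i ↦ dX u₁ i (0, x₁)) ∈ Ω₂)
    (hapos : 0 < 𝔞 ((0, x₁), u₁ (0, x₁))) {lam : ℝ} (hlam : 0 < lam)
    (hGpos : ∀ X : Fin d → F,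
      lam * ∑ i, ‖X i‖ ^ 2 ≤ ∑ i, ∑ j, 𝔊 i j ((0, x₁), u₁ (0, x₁)) * ⟪X i, X j⟫)
    (h₁ : ∀ᶠ p in 𝓝 ((0 : ℝ), x₁),
      op u₁ (fun q ↦ 𝔞 (q, u₁ q)) (fun i q ↦ 𝔟 i (q, u₁ q)) (fun i j q ↦ 𝔊 i j (q, u₁ q)) p =
        𝔑 (p, u₁ p, dT u₁ p, fun i ↦ dX u₁ i p))
    (h₂ : ∀ᶠ p in 𝓝 ((0 : ℝ), x₁),
      op u₂ (fun q ↦ 𝔞 (q, u₂ q)) (fun i q ↦ 𝔟 i (q, u₂ q)) (fun i j q ↦ 𝔊 i j (q, u₂ q)) p =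
        𝔑 (p, u₂ p, dT u₂ p, fun i ↦ dX u₂ i p))
    (h0 : ∀ᶠ y in 𝓝 x₁, u₁ (0, y) = u₂ (0, y)) (h1 : ∀ᶠ y in 𝓝 x₁, dT u₁ (0, y) = dT u₂ (0, y)) :
    ∀ᶠ p in 𝓝 ((0 : ℝ), x₁), u₁ p = u₂ p := by
  set p₀ : Pt d := ((0 : ℝ), x₁) with hp₀
  -- Step 1: cut off the solutions
  obtain ⟨U', hU'sub, hU'o, hp₀U'⟩ := _root_.mem_nhds_iff.1 hU
  obtain ⟨r₀, hr₀, hball₀⟩ := Metric.mem_nhds_iff.1 (hU'o.mem_nhds hp₀U')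
  let χ : ContDiffBump p₀ := ⟨r₀ / 4, r₀ / 2, by positivity, by linarith⟩
  have hχsub : closedBall p₀ χ.rOut ⊆ U' := fun q hq ↦ hball₀ (by
    rw [mem_ball]; exact lt_of_le_of_lt (mem_closedBall.1 hq) (by show r₀ / 2 < r₀; linarith))
  set v₁ : Pt d → F := fun q ↦ χ q • u₁ q with hv₁
  set v₂ : Pt d → F := fun q ↦ χ q • u₂ q with hv₂
  have hv₁s : ContDiff ℝ ∞ v₁ := contDiff_bump_smul χ hU'o hχsub (hu₁.mono hU'sub)
  have hv₂s : ContDiff ℝ ∞ v₂ := contDiff_bump_smul χ hU'o hχsub (hu₂.mono hU'sub)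
  set S : Set (Pt d) := ball p₀ χ.rIn with hS
  have hSo : IsOpen S := isOpen_ball
  have hp₀S : p₀ ∈ S := mem_ball_self χ.rIn_pos
  have hSn : S ∈ 𝓝 p₀ := hSo.mem_nhds hp₀S
  have he₁ : EqOn v₁ u₁ S := eqOn_bump_smul χ u₁
  have he₂ : EqOn v₂ u₂ S := eqOn_bump_smul χ u₂
  -- jets of the cut-off solutions on `S`
  have hj : ∀ {v u : Pt d → F}, EqOn v u S → ∀ p ∈ S, v p = u p ∧ dT v p = dT u p ∧
      (∀ i, dX v i p = dX u i p) ∧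
      ∀ (a : Pt d → ℝ) (b : Fin d → Pt d → ℝ) (G : Fin d → Fin d → Pt d → ℝ),
        op v a b G p = op u a b G p :=
    fun he p hp ↦ ⟨he hp, dT_congr hSo he hp, fun i ↦ dX_congr hSo he i hp,
      fun a b G ↦ op_congr hSo he a b G hp⟩
  -- Step 2: cut off the coefficients around the base jets
  set J₁ : Pt d × F := (p₀, u₁ p₀) with hJ₁
  set J₂ : Pt d × F × F × (Fin d → F) := (p₀, u₁ p₀, dT u₁ p₀, fun i ↦ dX u₁ i p₀) with hJ₂
  obtain ⟨s₁, hs₁, hballs₁⟩ := Metric.mem_nhds_iff.1 (hΩ₁.mem_nhds hm₁)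
  obtain ⟨s₂, hs₂, hballs₂⟩ := Metric.mem_nhds_iff.1 (hΩ₂.mem_nhds hm₂)
  let φ₁ : ContDiffBump J₁ := ⟨s₁ / 4, s₁ / 2, by positivity, by linarith⟩
  let φ₂ : ContDiffBump J₂ := ⟨s₂ / 4, s₂ / 2, by positivity, by linarith⟩
  have hφ₁sub : closedBall J₁ φ₁.rOut ⊆ Ω₁ := fun q hq ↦ hballs₁ (by
    rw [mem_ball]; exact lt_of_le_of_lt (mem_closedBall.1 hq) (by show s₁ / 2 < s₁; linarith))
  have hφ₂sub : closedBall J₂ φ₂.rOut ⊆ Ω₂ := fun q hq ↦ hballs₂ (by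
    rw [mem_ball]; exact lt_of_le_of_lt (mem_closedBall.1 hq) (by show s₂ / 2 < s₂; linarith))
  set 𝔞' : Pt d × F → ℝ := fun q ↦ φ₁ q • 𝔞 q with h𝔞'
  set 𝔟' : Fin d → Pt d × F → ℝ := fun i q ↦ φ₁ q • 𝔟 i q with h𝔟'
  set 𝔊' : Fin d → Fin d → Pt d × F → ℝ := fun i j q ↦ φ₁ q • 𝔊 i j q with h𝔊'
  set 𝔑' : Pt d × F × F × (Fin d → F) → F := fun q ↦ φ₂ q • 𝔑 q with h𝔑'
  have h𝔞's : ContDiff ℝ ∞ 𝔞' := contDiff_bump_smul φ₁ hΩ₁ hφ₁sub h𝔞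
  have h𝔟's : ∀ i, ContDiff ℝ ∞ (𝔟' i) := fun i ↦ contDiff_bump_smul φ₁ hΩ₁ hφ₁sub (h𝔟 i)
  have h𝔊's : ∀ i j, ContDiff ℝ ∞ (𝔊' i j) := fun i j ↦ contDiff_bump_smul φ₁ hΩ₁ hφ₁sub (h𝔊 i j)
  have h𝔊's' : ∀ i j q, 𝔊' i j q = 𝔊' j i q := fun i j q ↦ by simp only [h𝔊', h𝔊s i j q]
  have h𝔑's : ContDiff ℝ ∞ 𝔑' := contDiff_bump_smul φ₂ hΩ₂ hφ₂sub h𝔑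
  have he𝔞 : EqOn 𝔞' 𝔞 (ball J₁ φ₁.rIn) := eqOn_bump_smul φ₁ 𝔞
  have he𝔟 : ∀ i, EqOn (𝔟' i) (𝔟 i) (ball J₁ φ₁.rIn) := fun i ↦ eqOn_bump_smul φ₁ (𝔟 i)
  have he𝔊 : ∀ i j, EqOn (𝔊' i j) (𝔊 i j) (ball J₁ φ₁.rIn) := fun i j ↦ eqOn_bump_smul φ₁ (𝔊 i j)
  have he𝔑 : EqOn 𝔑' 𝔑 (ball J₂ φ₂.rIn) := eqOn_bump_smul φ₂ 𝔑
  -- Step 3: the base jets of `v₁`, `v₂` are `J₁`, `J₂`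
  have hv₁u₁ : v₁ =ᶠ[𝓝 p₀] u₁ := Filter.eventuallyEq_of_mem hSn he₁
  have hv₂u₂ : v₂ =ᶠ[𝓝 p₀] u₂ := Filter.eventuallyEq_of_mem hSn he₂
  obtain ⟨hb₁0, hb₁T, hb₁X, -⟩ := hj he₁ p₀ hp₀S
  obtain ⟨hb₂0, hb₂T, hb₂X, -⟩ := hj he₂ p₀ hp₀S
  have h0' : ∀ᶠ y in 𝓝 x₁, v₁ (0, y) = v₂ (0, y) := by
    have hc : ContinuousAt (fun y : EuclideanSpace ℝ (Fin d) ↦ (((0 : ℝ), y) : Pt d)) x₁ :=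
      (continuous_const.prodMk continuous_id).continuousAt
    filter_upwards [h0, hc.preimage_mem_nhds hSn] with y hy hyS
    rw [he₁ hyS, he₂ hyS, hy]
  have h1' : ∀ᶠ y in 𝓝 x₁, dT v₁ (0, y) = dT v₂ (0, y) := by
    have hc : ContinuousAt (fun y : EuclideanSpace ℝ (Fin d) ↦ (((0 : ℝ), y) : Pt d)) x₁ :=
      (continuous_const.prodMk continuous_id).continuousAt
    filter_upwards [h1, hc.preimage_mem_nhds hSn] with y hy hyS
    rw [dT_congr hSo he₁ hyS, dT_congr hSo he₂ hyS, hy]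
  have hX₂ : ∀ i, dX v₂ i p₀ = dX u₁ i p₀ := fun i ↦ by
    rw [← hb₁X i]; exact (dX_eq_of_data_eventuallyEq hv₁s hv₂s h0' i).symm
  have hT₂ : dT v₂ p₀ = dT u₁ p₀ := by rw [← hb₁T]; exact (h1'.self_of_nhds).symm
  have h0₂ : v₂ p₀ = u₁ p₀ := by rw [← hb₁0]; exact (h0'.self_of_nhds).symm
  -- Step 4: the conditions defining the small cylinder, as neighbourhoods of `p₀`
  -- (a) equations with cut-off data: jets in the inner balls
  have hjc : ∀ {v : Pt d → F}, ContDiff ℝ ∞ v → v p₀ = u₁ p₀ → dT v p₀ = dT u₁ p₀ →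
      (∀ i, dX v i p₀ = dX u₁ i p₀) →
      ∀ᶠ p in 𝓝 p₀, (p, v p) ∈ ball J₁ φ₁.rIn ∧
        (p, v p, dT v p, fun i ↦ dX v i p) ∈ ball J₂ φ₂.rIn := by
    intro v hv hv0 hvT hvX
    have hc1 : Continuous fun p : Pt d ↦ ((p, v p) : Pt d × F) := continuous_id.prodMk hv.continuous
    have hc2 : Continuous fun p : Pt d ↦ ((p, v p, dT v p, fun i ↦ dX v i p) :
        Pt d × F × F × (Fin d → F)) :=
      continuous_id.prodMk (hv.continuous.prodMk ((contDiff_dT hv).continuous.prodMk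
        (continuous_pi fun i ↦ (contDiff_dX hv i).continuous)))
    have h1 : (fun p : Pt d ↦ ((p, v p) : Pt d × F)) p₀ ∈ ball J₁ φ₁.rIn := by
      simp only [hv0]; exact mem_ball_self φ₁.rIn_pos
    have h2 : (fun p : Pt d ↦ ((p, v p, dT v p, fun i ↦ dX v i p) : Pt d × F × F × (Fin d → F))) p₀ ∈
        ball J₂ φ₂.rIn := by
      simp only [hv0, hvT, hvX]; exact mem_ball_self φ₂.rIn_pos
    have e1 : ∀ᶠ p in 𝓝 p₀, (p, v p) ∈ ball J₁ φ₁.rIn :=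
      hc1.continuousAt.preimage_mem_nhds (isOpen_ball.mem_nhds h1)
    have e2 : ∀ᶠ p in 𝓝 p₀, (p, v p, dT v p, fun i ↦ dX v i p) ∈ ball J₂ φ₂.rIn :=
      hc2.continuousAt.preimage_mem_nhds (isOpen_ball.mem_nhds h2)
    exact e1.and e2
  have hjc₁ := hjc hv₁s hb₁0 hb₁T hb₁X
  have hjc₂ := hjc hv₂s h0₂ hT₂ hX₂
  -- (b) positivity along `v₁`
  have hd : (0 : ℝ) ≤ d := Nat.cast_nonneg d
  set η : ℝ := lam / (4 * d + 4) with hη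
  have hηpos : 0 < η := by positivity
  have hc1 : Continuous fun p : Pt d ↦ ((p, v₁ p) : Pt d × F) := continuous_id.prodMk hv₁s.continuous
  have hbase : ((p₀, v₁ p₀) : Pt d × F) = J₁ := by rw [hb₁0]
  have hΩ₁n : Ω₁ ∈ 𝓝 J₁ := hΩ₁.mem_nhds hm₁
  have h𝔞c : ContinuousAt (fun p : Pt d ↦ 𝔞 (p, v₁ p)) p₀ :=
    (h𝔞.continuousOn.continuousAt hΩ₁n).comp_of_eq hc1.continuousAt hbase
  have h𝔊c : ∀ i j, ContinuousAt (fun p : Pt d ↦ 𝔊 i j (p, v₁ p)) p₀ := fun i j ↦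
    ((h𝔊 i j).continuousOn.continuousAt hΩ₁n).comp_of_eq hc1.continuousAt hbase
  have hA : ∀ᶠ p in 𝓝 p₀, 𝔞 J₁ / 2 ≤ 𝔞 (p, v₁ p) := by
    have hlt : (fun _ : Pt d ↦ 𝔞 J₁ / 2) p₀ < (fun p : Pt d ↦ 𝔞 (p, v₁ p)) p₀ := by
      show 𝔞 J₁ / 2 < 𝔞 (p₀, v₁ p₀)
      rw [hbase]
      linarith
    exact (continuousAt_const.eventually_lt h𝔞c hlt).mono fun p hp ↦ hp.le
  have hB : ∀ i j, ∀ᶠ p in 𝓝 p₀, |𝔊 i j (p, v₁ p) - 𝔊 i j J₁| < η := fun i j ↦ by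
    have h := Metric.tendsto_nhds.1 (h𝔊c i j) η hηpos
    refine h.mono fun p hp ↦ ?_
    have hp' : dist (𝔊 i j (p, v₁ p)) (𝔊 i j (p₀, v₁ p₀)) < η := hp
    rwa [Real.dist_eq, hbase] at hp'
  have hpos : ∀ᶠ p in 𝓝 p₀, 𝔞 J₁ / 2 ≤ 𝔞 (p, v₁ p) ∧ ∀ i j, |𝔊 i j (p, v₁ p) - 𝔊 i j J₁| < η := by
    refine hA.and ?_
    have hB' : ∀ᶠ p in 𝓝 p₀, ∀ ij : Fin d × Fin d, |𝔊 ij.1 ij.2 (p, v₁ p) - 𝔊 ij.1 ij.2 J₁| < η :=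
      Filter.eventually_all.2 fun ij ↦ hB ij.1 ij.2
    exact hB'.mono fun p hp i j ↦ hp (i, j)
  -- Step 5: a radius realising all conditions
  obtain ⟨r, hr, hballr⟩ := Metric.mem_nhds_iff.1
    ((((hjc₁.and hjc₂).and hpos).and ((h₁.and h₂).and hSn)))
  obtain ⟨ρ', hρ', hballρ'⟩ := Metric.mem_nhds_iff.1 (h0'.and h1')
  set R : ℝ := min (r / 2) (ρ' / 2) with hR
  have hRpos : 0 < R := by positivity
  have hRr : R < r := lt_of_le_of_lt (min_le_left _ _) (by linarith)
  have hRρ : R < ρ' := lt_of_le_of_lt (min_le_right _ _) (by linarith)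
  have hZball : ∀ p ∈ Icc (-R) R ×ˢ closedBall x₁ R, p ∈ ball p₀ r := by
    rintro ⟨t, y⟩ ⟨⟨ht1, ht2⟩, hy⟩
    rw [mem_ball, Prod.dist_eq, max_lt_iff]
    refine ⟨?_, lt_of_le_of_lt (mem_closedBall.1 hy) hRr⟩
    show dist t 0 < r
    rw [Real.dist_eq, sub_zero]
    exact lt_of_le_of_lt (abs_le.2 ⟨ht1, ht2⟩) hRr
  have hall : ∀ p ∈ Icc (-R) R ×ˢ closedBall x₁ R,
      (((p, v₁ p) ∈ ball J₁ φ₁.rIn ∧ (p, v₁ p, dT v₁ p, fun i ↦ dX v₁ i p) ∈ ball J₂ φ₂.rIn) ∧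
        ((p, v₂ p) ∈ ball J₁ φ₁.rIn ∧ (p, v₂ p, dT v₂ p, fun i ↦ dX v₂ i p) ∈ ball J₂ φ₂.rIn)) ∧
      (𝔞 J₁ / 2 ≤ 𝔞 (p, v₁ p) ∧ ∀ i j, |𝔊 i j (p, v₁ p) - 𝔊 i j J₁| < η) := fun p hp ↦
    (hballr (hZball p hp)).1
  have hall' : ∀ p ∈ Icc (-R) R ×ˢ closedBall x₁ R,
      (op u₁ (fun q ↦ 𝔞 (q, u₁ q)) (fun i q ↦ 𝔟 i (q, u₁ q)) (fun i j q ↦ 𝔊 i j (q, u₁ q)) p =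
          𝔑 (p, u₁ p, dT u₁ p, fun i ↦ dX u₁ i p) ∧
        op u₂ (fun q ↦ 𝔞 (q, u₂ q)) (fun i q ↦ 𝔟 i (q, u₂ q)) (fun i j q ↦ 𝔊 i j (q, u₂ q)) p =
          𝔑 (p, u₂ p, dT u₂ p, fun i ↦ dX u₂ i p)) ∧ p ∈ S := fun p hp ↦
    (hballr (hZball p hp)).2
  -- the equation for a cut-off solution at a point of the cylinder
  have heq : ∀ {v u : Pt d → F} (he : EqOn v u S) (p : Pt d), p ∈ S →
      (p, v p) ∈ ball J₁ φ₁.rIn → (p, v p, dT v p, fun i ↦ dX v i p) ∈ ball J₂ φ₂.rIn →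
      op u (fun q ↦ 𝔞 (q, u q)) (fun i q ↦ 𝔟 i (q, u q)) (fun i j q ↦ 𝔊 i j (q, u q)) p =
        𝔑 (p, u p, dT u p, fun i ↦ dX u i p) →
      op v (fun q ↦ 𝔞' (q, v q)) (fun i q ↦ 𝔟' i (q, v q)) (fun i j q ↦ 𝔊' i j (q, v q)) p =
        𝔑' (p, v p, dT v p, fun i ↦ dX v i p) := by
    intro v u he p hpS hq₁ hq₂ hsol
    obtain ⟨hv0, hvT, hvX, hvop⟩ := hj he p hpS
    have hN : 𝔑' (p, v p, dT v p, fun i ↦ dX v i p) = 𝔑 (p, u p, dT u p, fun i ↦ dX u i p) := by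
      rw [he𝔑 hq₂, hv0, hvT]
      simp only [hvX]
    rw [hN, ← hsol, ← hvop]
    refine op_coef_congr v ?_ (fun i ↦ ?_) (fun i j ↦ ?_)
    · show 𝔞' (p, v p) = 𝔞 (p, u p)
      rw [he𝔞 hq₁, hv0]
    · show 𝔟' i (p, v p) = 𝔟 i (p, u p)
      rw [he𝔟 i hq₁, hv0]
    · show 𝔊' i j (p, v p) = 𝔊 i j (p, u p)
      rw [he𝔊 i j hq₁, hv0]
  -- Step 6: apply the two-sided theorem to the cut-off objects
  have key := eventually_eq_of_quasilinear (𝔞 := 𝔞') (𝔟 := 𝔟') (𝔊 := 𝔊') (𝔑 := 𝔑') (T := R)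
    (ρ := R) (lam := min (𝔞 J₁ / 2) (lam / 2)) (x₁ := x₁) (u₁ := v₁) (u₂ := v₂)
    h𝔞's h𝔟's h𝔊's h𝔊's' h𝔑's hRpos hRpos (lt_min (by linarith) (by linarith)) hv₁s hv₂s
    (fun p hp ↦ by
      obtain ⟨⟨⟨hq₁, -⟩, -⟩, hap, -⟩ := hall p hp
      rw [he𝔞 hq₁]
      exact (min_le_left _ _).trans hap)
    (fun p hp X ↦ by
      obtain ⟨⟨⟨hq₁, -⟩, -⟩, -, hGp⟩ := hall p hp
      simp only [he𝔊 _ _ hq₁]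
      -- perturbation of the positivity at the base jet
      have hbaseX := hGpos X
      have hdiff : |∑ i, ∑ j, (𝔊 i j (p, v₁ p) - 𝔊 i j J₁) * ⟪X i, X j⟫| ≤
          η * (2 * d * ∑ j, ‖X j‖ ^ 2) :=
        (abs_sum_sum_mul_inner_le (fun i j ↦ (hGp i j).le) X X).trans
          (mul_le_mul_of_nonneg_left (sum_sum_norm_mul_norm_le X) hηpos.le)
      have hsplit : ∑ i, ∑ j, 𝔊 i j (p, v₁ p) * ⟪X i, X j⟫ =
          ∑ i, ∑ j, 𝔊 i j J₁ * ⟪X i, X j⟫ +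
            ∑ i, ∑ j, (𝔊 i j (p, v₁ p) - 𝔊 i j J₁) * ⟪X i, X j⟫ := by
        rw [← Finset.sum_add_distrib]
        refine Finset.sum_congr rfl fun i _ ↦ ?_
        rw [← Finset.sum_add_distrib]
        exact Finset.sum_congr rfl fun j _ ↦ by ring
      have hηd : η * (2 * d) ≤ lam / 2 := by
        rw [hη, div_mul_eq_mul_div, div_le_iff₀ (by positivity)]
        nlinarith
      have hS0 : 0 ≤ ∑ j, ‖X j‖ ^ 2 := by positivity
      have hlow := (abs_le.1 hdiff).1
      calc min (𝔞 J₁ / 2) (lam / 2) * ∑ i, ‖X i‖ ^ 2 ≤ lam / 2 * ∑ i, ‖X i‖ ^ 2 :=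
            mul_le_mul_of_nonneg_right (min_le_right _ _) hS0
        _ ≤ _ := by
            rw [hsplit]
            nlinarith [mul_le_mul_of_nonneg_right hηd hS0])
    (fun p hp ↦ by
      obtain ⟨⟨⟨hq₁, hq₂⟩, -⟩, -⟩ := hall p hp
      obtain ⟨⟨hs1, -⟩, hpS⟩ := hall' p hp
      exact heq he₁ p hpS hq₁ hq₂ hs1)
    (fun p hp ↦ by
      obtain ⟨⟨-, ⟨hq₁, hq₂⟩⟩, -⟩ := hall p hp
      obtain ⟨⟨-, hs2⟩, hpS⟩ := hall' p hp
      exact heq he₂ p hpS hq₁ hq₂ hs2)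
    (fun y hy ↦ (hballρ' (closedBall_subset_ball hRρ hy)).1)
    (fun y hy ↦ (hballρ' (closedBall_subset_ball hRρ hy)).2)
  filter_upwards [key, hv₁u₁, hv₂u₂] with p hk h1 h2
  rw [← h1, hk, h2]

end Germ

/-! ### Positivity for Euclidean-space-valued systems -/

/-- For systems with values in `ℝᴵ` the matrix condition `∑ Mᵢⱼ ξᵢ ξⱼ ≥ λ |ξ|²` implies the
vector condition `∑ Mᵢⱼ ⟪Xᵢ, Xⱼ⟫ ≥ λ ∑ ‖Xᵢ‖²` used above (apply it componentwise and sum).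
[folklore] -/
theorem sum_sum_mul_inner_ge {ι : Type*} [Fintype ι] {M : Fin d → Fin d → ℝ} {lam : ℝ}
    (hM : ∀ ξ : Fin d → ℝ, lam * ∑ i, ξ i ^ 2 ≤ ∑ i, ∑ j, M i j * (ξ i * ξ j))
    (X : Fin d → EuclideanSpace ℝ ι) :
    lam * ∑ i, ‖X i‖ ^ 2 ≤ ∑ i, ∑ j, M i j * ⟪X i, X j⟫ := by
  have hn : ∀ i, ‖X i‖ ^ 2 = ∑ m, X i m ^ 2 := fun i ↦ by
    rw [EuclideanSpace.norm_sq_eq]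
    exact Finset.sum_congr rfl fun m _ ↦ by rw [Real.norm_eq_abs, sq_abs]
  have hi : ∀ i j, ⟪X i, X j⟫ = ∑ m, X i m * X j m := fun i j ↦ by
    simp only [PiLp.inner_apply, RCLike.inner_apply, conj_trivial]
    exact Finset.sum_congr rfl fun m _ ↦ mul_comm _ _
  calc lam * ∑ i, ‖X i‖ ^ 2 = ∑ m, lam * ∑ i, X i m ^ 2 := by
        simp only [hn]
        rw [Finset.sum_comm, Finset.mul_sum]
    _ ≤ ∑ m, ∑ i, ∑ j, M i j * (X i m * X j m) := Finset.sum_le_sum fun m _ ↦ hM fun i ↦ X i m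
    _ = ∑ i, ∑ j, M i j * ⟪X i, X j⟫ := by
        simp only [hi, Finset.mul_sum]
        rw [Finset.sum_comm]
        refine Finset.sum_congr rfl fun i _ ↦ ?_
        rw [Finset.sum_comm]

end VarWave

end Literature.Analysis.PDE
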